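import Summits.QuantumFields.YangMills.Theorems.UnitScaleTiltProp7SectET3OpsT3HilbertRows
import Summits.QuantumFields.YangMills.Theorems.UnitScaleTiltProp7SectET3DeltaOneT3PInv
import Summits.QuantumFields.YangMills.Theorems.UnitScaleTiltProp7KernelColumnRowDuality
import HarnessLib

/-!
# Route `UnitScaleTilt`, crux K1 «MinimiserStabilityRegPr» (stmt-QuantumFields-19200), EX row `norm_G` (S47 ✓p766895), NORM_G ROAD N2 (★p1 g27 CHAIR WORD №24) —
# **(3.152) AT THE TREE LETTERS: `G D R_S = D G′ᴾ R_S` and `R_S D* G = R_S G′ᴾ D*` ON THE CLASS, FOR EVERY HESSIAN SLOT THAT KILLS `D N_S`; HENCE THE THIRD WORD OF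
# `𝔊 = G𝔓*` IS `(1 − Pᴾ)G` AND `𝔊 = Pᴾ∘G − H∘Q_k∘G` (TWO WORDS)**

Cell `ym3-torus` (HUMAN RULING D-0037; rung R3 = SU(2) YM₃ on T³ — NOT d = 4, NOT infinite volume, NOT a mass gap, NOT Clay).  Width seat `ym3-torus-px17` (gen 11),
LOCATE note 09:25:52Z for the chair's pen N2.  THEOREMS ONLY (0 `def`, 0 `sorry`, default heartbeats); `--supports stmt-QuantumFields-19200 --as helper`; count-neutral.

THE PRINT.  [Balaban1985BackgroundPropagators] p. 426: «… hence (3.151) gives RD*G₁ = RG′D*, and G₁DR = DG′R. (3.152) Let us notice that these identities imply the identities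
(3.124), because QG₁DR = QDG′R = D¹Q′G′R = 0.»; p. 425 (3.147) «𝔓 = I − G₁Q*(QG₁Q*)⁻¹Q − G₁DRD*»; p. 426 (3.153) «the operator G₁𝔓* is equal to the operator 𝔊»; p. 419 (3.119)
(the gauge transformation `A ↦ A − DG′RD*A` to the subspace `{RD*A = 0}`).  Print derives (3.152) through the Gaussian identity (3.151) (p. 425); here (as in lit's ring-level twin
✓`B9Eq3152.eq_3152`, pub-balaban b09) it follows from the action of `Δ_a` on the residual pure gauge modes: for `λ ∈ N_S(U₀)`, `Δ_a(Dλ) = D(Δ^ηλ)` when the Hessian slot kills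
`Dλ` (✓`laplaceA_DL2_of_mem_NS`), and `D G′ᴾ(Δ^ηλ) = Dλ` (✓`DL2_GprimeP_covLapSite_of_mem_NS`); `R_S f = Δ^ηλ₀` with `λ₀ ∈ N_S` (✓`exists_mem_NS_RS_eq`).

WHAT IS PROVED (ns `Summit.QuantumFields.YangMills.Theorems.Prop7FrakGEq3152`; letters of ✓`Prop7SectET3CurvedPropagatorsT3` (`Qk`, `laplaceA`, `PosOnto`, `GT`, `KinvT`, `HT`, `frakGT`),
✓`Prop7SectET3DeltaPiT3PInv` (`GprimeP`, `gaugeCorrP = Pᴾ`, `DeltaPiSlotP`), ✓`Prop7SectET3DeltaOneT3PInv` (`DeltaOneP TJ`); hypotheses: the class `hp : PosOnto … Δx U₀`, the slot letter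
`hΔ : ∀ l ∈ N_S, Δx U₀ (Dl) = 0` (DISCHARGED for both slots of record in §4), `0 ≤ a′` for `G′ᴾ`'s coupling — which is FREE and independent of the display's `a`):
* §1 (3.152)₂ ★★ `GT_DL2_RS_eq_DL2_GprimeP_RS` (`G(D(R_S f)) = D(G′ᴾ(R_S f))` for every site field `f`), `GT_comp_DL2_comp_RS` (operator form).
* §2 (3.152)₁ = (3.151)'s conclusion ★★ `RS_DstarL2_GT_eq_RS_GprimeP_DstarL2` (`R_S(D*(Gx)) = R_S(G′ᴾ(D*x))`, Hessian slot symmetric), by adjoints (✓`GT_isSymmetric`, ✓`GprimeP_isSymmetric`,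
  ✓`RS_isSymmetric`, ✓`adjoint_DL2`).
* §3 ★★ `GT_DL2_RS_DstarL2_GT_eq` (third word `G D R_S D* G = (1 − Pᴾ) G`), `frakGT_apply_three_words` (lit ✓`frakGLin_apply` at the total letters, unconditional),
  ★★★ `frakGT_eq_gaugeCorrP_sub_HT` (**`𝔊x = Pᴾ(Gx) − H(Q_k(Gx))`** on the class), `frakGT_eq_comp` (`𝔊 = Pᴾ∘G − H∘Q_k∘G`).
* §4 slot editions, `hΔ` discharged: ★★★ `frakGT_DeltaPiSlotP_eq` (the Π-slot `G = G_π` of (3.122), `0 ≤ a`), ★★★ `frakGT_DeltaOneP_eq` (the slot `Δ₁ = Pᴾ†(Δ^η + T_J)Pᴾ` of (3.128), ANY `T_J`,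
  `0 ≤ a`; `DeltaOnePJ = DeltaOneP TJSlotP` is the display's `G₁`).
HONEST SCOPE.  Linear algebra over landed identities; no estimate.  (3.152) is a `G_π`∕`G₁` identity — it is NOT claimed for the bare-Hessian slot `DeltaEtaSlot` (`Δ^η` does not kill
curved gauge modes; (3.117) pairing).  Nothing of `norm_G`, the eight EX print rows, `hThm2S`, EX `stub_existenceMinimalOrbit`, `MinimiserStabilityRegPr` (19200) or R3 is proved; the
Yang–Mills mass gap is NOT proved.

References: T. Bałaban, CMP **99** (1985) 389–434 [Balaban1985BackgroundPropagators] ((3.119) p.419, (3.122)–(3.126) p.420, (3.128) p.421, (3.147) p.425, (3.151) p.425, (3.152)–(3.153) p.426);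
CMP **102** (1985) 277–309 [Balaban1985Variational] ((110)–(111) p.294); CMP **96** (1984) 223–250 [Balaban1984PropagatorsII] ((2.31) p.227).
-/

set_option autoImplicit false

noncomputable section

open scoped InnerProductSpace ComplexConjugate Matrix.Norms.L2Operator

namespace Summit.QuantumFields.YangMills.Theorems.Prop7FrakGEq3152

open Literature.MathematicalPhysics.QuantumFieldTheory.Balaban1983to89
open Literature.MathematicalPhysics.QuantumFieldTheory.Balaban1983to89.T3ContinuumYM3Torus
open B9Eq311L2Pairing (WL2)
open B11Eq111FrakG (frakGLin_apply)
open B11Eq103H1Complex (SiteL2K BondL2K)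
open Summit.QuantumFields.YangMills.Theorems.Prop7SectET3Transport (periodsT3)
open Summit.QuantumFields.YangMills.Theorems.Prop7SectET3HilbertLetters (W₂ QL2 DL2 DstarL2 covLapSite adjoint_DL2)
open Summit.QuantumFields.YangMills.Theorems.Prop7SectET3GaugeProjector (NS RS RS_isSymmetric)
open Summit.QuantumFields.YangMills.Theorems.Prop7SectET3CurvedPropagators (Qk laplaceA PosOnto GT KinvT HT frakGT HT_eq_comp GT_DL2_RS)
open Summit.QuantumFields.YangMills.Theorems.Prop7SectET3OpsT3HilbertRows (GT_isSymmetric)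
open Summit.QuantumFields.YangMills.Theorems.Prop7SectET3DeltaPiPInv (GprimeP gaugeCorrP DeltaPiP DeltaPiSlotP gaugeCorrP_apply DL2_GprimeP_covLapSite_of_mem_NS
  DeltaPiSlotP_kills_NS)
open Summit.QuantumFields.YangMills.Theorems.Prop7SectET3DeltaOnePInv (DeltaOneP DeltaOneP_kills_NS)
open Summit.QuantumFields.YangMills.Theorems.Prop7KernelColumnRowDuality (GprimeP_isSymmetric)

variable {F : T3Family} {n K : ℕ} {h : n ≤ K} {c₀ cB a a' : ℝ} [Fact (0 < c₀)] [Fact (0 < cB)]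
  {Δx : GaugeField (F.P K) 0 (Matrix.specialUnitaryGroup (Fin 2) ℂ) → (BondL2K ℂ 3 (periodsT3 F K) c₀ W₂ →ₗ[ℂ] BondL2K ℂ 3 (periodsT3 F K) c₀ W₂)}

/-! ## §1 (3.152)₂: `G D R_S = D G′ᴾ R_S` on the class -/

/-- ★★ **(3.152)₂ AT THE TREE LETTERS: `G(U₀)(D_{U₀}(R_S f)) = D_{U₀}(G′ᴾ(U₀)(R_S f))`** for every site field `f`, on the class `PosOnto`, for every Hessian slot `Δx` killing `D N_S`
and every coupling `0 ≤ a′` of `G′ᴾ` (`R_S f = Δ^ηλ₀`, `λ₀ ∈ N_S`: ✓`GT_DL2_RS` gives `G(D(R_S f)) = Dλ₀`, and `D(G′ᴾ(Δ^ηλ₀)) = Dλ₀`).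
[cite: Balaban1985BackgroundPropagators, (3.152) p.426, (3.124) p.420, (3.24)–(3.25) p.394] -/
theorem GT_DL2_RS_eq_DL2_GprimeP_RS {U₀ : GaugeField (F.P K) 0 (Matrix.specialUnitaryGroup (Fin 2) ℂ)} (hp : PosOnto F n K h c₀ cB a Δx U₀)
    (hΔ : ∀ l ∈ NS F n K h c₀ cB U₀, Δx U₀ (DL2 F n K c₀ U₀ l) = 0) (ha' : 0 ≤ a') (f : SiteL2K ℂ 3 (periodsT3 F K) c₀ W₂) :
    GT F n K h c₀ cB a Δx U₀ (DL2 F n K c₀ U₀ (RS F n K h c₀ cB U₀ f)) =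
      DL2 F n K c₀ U₀ (GprimeP F n K h c₀ cB a' U₀ (RS F n K h c₀ cB U₀ f)) := by
  obtain ⟨l, hl, hf, hG⟩ := GT_DL2_RS hp hΔ f
  rw [hG, hf, DL2_GprimeP_covLapSite_of_mem_NS ha' U₀ hl]

/-- **(3.152)₂ AS AN OPERATOR IDENTITY: `G ∘ D ∘ R_S = D ∘ G′ᴾ ∘ R_S`.** [cite: Balaban1985BackgroundPropagators, (3.152) p.426] -/
theorem GT_comp_DL2_comp_RS {U₀ : GaugeField (F.P K) 0 (Matrix.specialUnitaryGroup (Fin 2) ℂ)} (hp : PosOnto F n K h c₀ cB a Δx U₀)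
    (hΔ : ∀ l ∈ NS F n K h c₀ cB U₀, Δx U₀ (DL2 F n K c₀ U₀ l) = 0) (ha' : 0 ≤ a') :
    GT F n K h c₀ cB a Δx U₀ ∘ₗ DL2 F n K c₀ U₀ ∘ₗ RS F n K h c₀ cB U₀ =
      DL2 F n K c₀ U₀ ∘ₗ GprimeP F n K h c₀ cB a' U₀ ∘ₗ RS F n K h c₀ cB U₀ :=
  LinearMap.ext fun f => GT_DL2_RS_eq_DL2_GprimeP_RS hp hΔ ha' f

/-! ## §2 (3.152)₁: `R_S D* G = R_S G′ᴾ D*` on the class (Hessian slot symmetric) -/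

/-- ★★ **(3.152)₁ AT THE TREE LETTERS: `R_S(D*_{U₀}(G(U₀)x)) = R_S(G′ᴾ(U₀)(D*_{U₀}x))`** — the adjoint of (3.152)₂ (`G`, `G′ᴾ`, `R_S` symmetric, `D* = D†`).
[cite: Balaban1985BackgroundPropagators, (3.151) p.425, (3.152) p.426, (3.8) p.392] -/
theorem RS_DstarL2_GT_eq_RS_GprimeP_DstarL2 {U₀ : GaugeField (F.P K) 0 (Matrix.specialUnitaryGroup (Fin 2) ℂ)} (hp : PosOnto F n K h c₀ cB a Δx U₀)
    (hΔs : (Δx U₀).IsSymmetric) (hΔ : ∀ l ∈ NS F n K h c₀ cB U₀, Δx U₀ (DL2 F n K c₀ U₀ l) = 0) (ha' : 0 ≤ a')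
    (x : BondL2K ℂ 3 (periodsT3 F K) c₀ W₂) :
    RS F n K h c₀ cB U₀ (DstarL2 F n K c₀ U₀ (GT F n K h c₀ cB a Δx U₀ x)) =
      RS F n K h c₀ cB U₀ (GprimeP F n K h c₀ cB a' U₀ (DstarL2 F n K c₀ U₀ x)) := by
  refine ext_inner_right ℂ fun t => ?_
  have h1 : ⟪RS F n K h c₀ cB U₀ (DstarL2 F n K c₀ U₀ (GT F n K h c₀ cB a Δx U₀ x)), t⟫_ℂ =
      ⟪x, DL2 F n K c₀ U₀ (GprimeP F n K h c₀ cB a' U₀ (RS F n K h c₀ cB U₀ t))⟫_ℂ := by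
    rw [RS_isSymmetric U₀, ← adjoint_DL2, LinearMap.adjoint_inner_left, GT_isSymmetric hp hΔs, GT_DL2_RS_eq_DL2_GprimeP_RS hp hΔ ha']
  have h2 : ⟪RS F n K h c₀ cB U₀ (GprimeP F n K h c₀ cB a' U₀ (DstarL2 F n K c₀ U₀ x)), t⟫_ℂ =
      ⟪x, DL2 F n K c₀ U₀ (GprimeP F n K h c₀ cB a' U₀ (RS F n K h c₀ cB U₀ t))⟫_ℂ := by
    rw [RS_isSymmetric U₀, GprimeP_isSymmetric F c₀ h cB a' ha' U₀, ← adjoint_DL2, LinearMap.adjoint_inner_left]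
  rw [h1, h2]

/-! ## §3 The third word of `𝔊 = G𝔓*` and the two-word form -/

/-- ★★ **THE THIRD WORD IS `(1 − Pᴾ)G`: `G(D(R_S(D*(Gx)))) = Gx − Pᴾ(Gx)`** on the class (`Pᴾ = 1 − DG′ᴾR_SD*`, ✓`gaugeCorrP_apply`; (3.152)₂ at `f := D*(Gx)`).
[cite: Balaban1985BackgroundPropagators, (3.119) p.419, (3.152)–(3.153) p.426] -/
theorem GT_DL2_RS_DstarL2_GT_eq {U₀ : GaugeField (F.P K) 0 (Matrix.specialUnitaryGroup (Fin 2) ℂ)} (hp : PosOnto F n K h c₀ cB a Δx U₀)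
    (hΔ : ∀ l ∈ NS F n K h c₀ cB U₀, Δx U₀ (DL2 F n K c₀ U₀ l) = 0) (ha' : 0 ≤ a') (x : BondL2K ℂ 3 (periodsT3 F K) c₀ W₂) :
    GT F n K h c₀ cB a Δx U₀ (DL2 F n K c₀ U₀ (RS F n K h c₀ cB U₀ (DstarL2 F n K c₀ U₀ (GT F n K h c₀ cB a Δx U₀ x)))) =
      GT F n K h c₀ cB a Δx U₀ x - gaugeCorrP F n K h c₀ cB a' U₀ (GT F n K h c₀ cB a Δx U₀ x) := by
  rw [GT_DL2_RS_eq_DL2_GprimeP_RS hp hΔ ha', gaugeCorrP_apply, sub_sub_cancel]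

/-- **`𝔊` UNFOLDED IN THREE WORDS at the total letters (lit ✓`frakGLin_apply`; unconditional): `𝔊x = Gx − G(Q_k†((Q_kGQ_k†)⁻¹(Q_k(Gx)))) − G(D(R_S(D*(Gx))))`.**
[cite: Balaban1985BackgroundPropagators, (3.153) p.426, (3.147) p.425; Balaban1985Variational, (110)–(111) p.294] -/
theorem frakGT_apply_three_words (U₀ : GaugeField (F.P K) 0 (Matrix.specialUnitaryGroup (Fin 2) ℂ)) (x : BondL2K ℂ 3 (periodsT3 F K) c₀ W₂) :
    frakGT F n K h c₀ cB a Δx U₀ x =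
      GT F n K h c₀ cB a Δx U₀ x
        - GT F n K h c₀ cB a Δx U₀ (LinearMap.adjoint (Qk F n K h c₀ cB U₀) (KinvT F n K h c₀ cB a Δx U₀ (Qk F n K h c₀ cB U₀ (GT F n K h c₀ cB a Δx U₀ x))))
        - GT F n K h c₀ cB a Δx U₀ (DL2 F n K c₀ U₀ (RS F n K h c₀ cB U₀ (DstarL2 F n K c₀ U₀ (GT F n K h c₀ cB a Δx U₀ x)))) :=
  frakGLin_apply _ _ _ _ _ _ _ x

/-- ★★★ **`𝔊 = PᴾG − HQ_kG` ON THE CLASS: `𝔊x = Pᴾ(Gx) − H(Q_k(Gx))`** — the third word `G D R_S D* G` absorbed into the gauge projector `Pᴾ = 1 − DG′ᴾR_SD*` by (3.152), the second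
word read through (3.126) `H = GQ_k†(Q_kGQ_k†)⁻¹` (✓`HT_eq_comp`); every Hessian slot killing `D N_S`, every `0 ≤ a′`.
[cite: Balaban1985BackgroundPropagators, (3.119) p.419, (3.126) p.420, (3.147) p.425, (3.152)–(3.153) p.426] -/
theorem frakGT_eq_gaugeCorrP_sub_HT {U₀ : GaugeField (F.P K) 0 (Matrix.specialUnitaryGroup (Fin 2) ℂ)} (hp : PosOnto F n K h c₀ cB a Δx U₀)
    (hΔ : ∀ l ∈ NS F n K h c₀ cB U₀, Δx U₀ (DL2 F n K c₀ U₀ l) = 0) (ha' : 0 ≤ a') (x : BondL2K ℂ 3 (periodsT3 F K) c₀ W₂) :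
    frakGT F n K h c₀ cB a Δx U₀ x =
      gaugeCorrP F n K h c₀ cB a' U₀ (GT F n K h c₀ cB a Δx U₀ x)
        - HT F n K h c₀ cB a Δx U₀ (Qk F n K h c₀ cB U₀ (GT F n K h c₀ cB a Δx U₀ x)) := by
  rw [frakGT_apply_three_words, GT_DL2_RS_DstarL2_GT_eq hp hΔ ha', HT_eq_comp hp]
  simp only [LinearMap.comp_apply]
  abel

/-- **`𝔊 = Pᴾ ∘ G − H ∘ Q_k ∘ G` AS AN OPERATOR IDENTITY ON THE CLASS.** [cite: Balaban1985BackgroundPropagators, (3.147) p.425, (3.152)–(3.153) p.426] -/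
theorem frakGT_eq_comp {U₀ : GaugeField (F.P K) 0 (Matrix.specialUnitaryGroup (Fin 2) ℂ)} (hp : PosOnto F n K h c₀ cB a Δx U₀)
    (hΔ : ∀ l ∈ NS F n K h c₀ cB U₀, Δx U₀ (DL2 F n K c₀ U₀ l) = 0) (ha' : 0 ≤ a') :
    frakGT F n K h c₀ cB a Δx U₀ =
      gaugeCorrP F n K h c₀ cB a' U₀ ∘ₗ GT F n K h c₀ cB a Δx U₀
        - HT F n K h c₀ cB a Δx U₀ ∘ₗ Qk F n K h c₀ cB U₀ ∘ₗ GT F n K h c₀ cB a Δx U₀ := by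
  refine LinearMap.ext fun x => ?_
  rw [frakGT_eq_gaugeCorrP_sub_HT hp hΔ ha' x]
  simp only [LinearMap.sub_apply, LinearMap.comp_apply]

/-! ## §4 The slots of record: `hΔ` discharged -/

/-- ★★★ **THE Π-SLOT (`G = G_π = (Δ_πᴾ + DR_SD* + Q_k†aQ_k)⁻¹` of (3.122)): `𝔊x = Pᴾ(Gx) − H(Q_k(Gx))`** on the class, `0 ≤ a` — `hΔ` discharged by ✓`DeltaPiSlotP_kills_NS`; `G′ᴾ`'s coupling
taken `:= a`. [cite: Balaban1985BackgroundPropagators, (3.119) p.419, (3.122) p.420, (3.152)–(3.153) p.426] -/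
theorem frakGT_DeltaPiSlotP_eq (ha : 0 ≤ a) {U₀ : GaugeField (F.P K) 0 (Matrix.specialUnitaryGroup (Fin 2) ℂ)}
    (hp : PosOnto F n K h c₀ cB a (DeltaPiSlotP F n K h c₀ cB a) U₀) (x : BondL2K ℂ 3 (periodsT3 F K) c₀ W₂) :
    frakGT F n K h c₀ cB a (DeltaPiSlotP F n K h c₀ cB a) U₀ x =
      gaugeCorrP F n K h c₀ cB a U₀ (GT F n K h c₀ cB a (DeltaPiSlotP F n K h c₀ cB a) U₀ x)
        - HT F n K h c₀ cB a (DeltaPiSlotP F n K h c₀ cB a) U₀ (Qk F n K h c₀ cB U₀ (GT F n K h c₀ cB a (DeltaPiSlotP F n K h c₀ cB a) U₀ x)) :=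
  frakGT_eq_gaugeCorrP_sub_HT hp (DeltaPiSlotP_kills_NS ha) ha x

/-- ★★★ **THE `Δ₁`-SLOT (`G = G₁ = (Pᴾ†(Δ^η + T_J)Pᴾ + DR_SD* + Q_k†aQ_k)⁻¹` of (3.128), ANY `T_J`; `DeltaOnePJ = DeltaOneP TJSlotP` is the display's): `𝔊x = Pᴾ(G₁x) − H₁(Q_k(G₁x))`**
on the class, `0 ≤ a` — `hΔ` discharged by ✓`DeltaOneP_kills_NS`. [cite: Balaban1985BackgroundPropagators, (3.128) p.421, (3.147) p.425, (3.152)–(3.153) p.426] -/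
theorem frakGT_DeltaOneP_eq (TJ : GaugeField (F.P K) 0 (Matrix.specialUnitaryGroup (Fin 2) ℂ) → (BondL2K ℂ 3 (periodsT3 F K) c₀ W₂ →ₗ[ℂ] BondL2K ℂ 3 (periodsT3 F K) c₀ W₂))
    (ha : 0 ≤ a) {U₀ : GaugeField (F.P K) 0 (Matrix.specialUnitaryGroup (Fin 2) ℂ)} (hp : PosOnto F n K h c₀ cB a (DeltaOneP F n K h c₀ cB a TJ) U₀)
    (x : BondL2K ℂ 3 (periodsT3 F K) c₀ W₂) :
    frakGT F n K h c₀ cB a (DeltaOneP F n K h c₀ cB a TJ) U₀ x =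
      gaugeCorrP F n K h c₀ cB a U₀ (GT F n K h c₀ cB a (DeltaOneP F n K h c₀ cB a TJ) U₀ x)
        - HT F n K h c₀ cB a (DeltaOneP F n K h c₀ cB a TJ) U₀ (Qk F n K h c₀ cB U₀ (GT F n K h c₀ cB a (DeltaOneP F n K h c₀ cB a TJ) U₀ x)) :=
  frakGT_eq_gaugeCorrP_sub_HT hp (DeltaOneP_kills_NS TJ ha) ha x

end Summit.QuantumFields.YangMills.Theorems.Prop7FrakGEq3152

end
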